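import Summits.AnomalousDissipation.AnomalousDissipation.Theorems.SawtoothPulseCascadeK1LocalisedCascadeKHModePairedCreation
import Summits.AnomalousDissipation.AnomalousDissipation.Theorems.SawtoothPulseCascadeK1LocalisedCascadeKHModeSquareSum

/-!
# Sawtooth pulse cascade, crux `K1LocalisedCascade` — the paired creation weights on the lines `a ≥ 2` (K2 lane, p2 g12)

The numerics of `…KHModePairedCreation` / `…KHModeSquareSum` (stated there for `a ≥ 4`) one octave lower: for `2 ≤ a` the decay number is
`x = e^{-πa/2} ≤ e^{-π} ≤ 1/20` (instead of `1/400`), the comb ratio defect is `≤ 1/100`, the paired mode factor is `≤ 5.08/a` on every mode and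
`≤ 26/(a(1+(|ξ/a|−8)²))` on the far modes `|ξ| ≥ 16a`, and the square sum of the weights `5.08/a` (near) / `104a/ξ²` (far) is `≤ 220000·a`.
These feed the energy-form creation law on the lines `2 ≤ |a| < 4` (crux `K2CreationLaws.lean` §27), shrinking the core-line law of record to `|a| < 2`.
-/

namespace Summit.AnomalousDissipation.AnomalousDissipation.Theorems.SawtoothPulseCascade.K2PhaseBudget

open Literature.Analysis.FluidPDE.SawtoothCascade

noncomputable section

variable {a : ℝ}

/-- `e^{-3} ≤ 1/20` (`e ≥ 2.718281828`). [folklore] -/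
theorem exp_neg_three_le : Real.exp (-3) ≤ 1 / 20 := by
  have h1 : (2.7182818283 : ℝ) < Real.exp 1 := Real.exp_one_gt_d9
  have h3 : Real.exp 3 = Real.exp 1 ^ 3 := by rw [← Real.exp_nat_mul]; norm_num
  have h20 : (20 : ℝ) ≤ Real.exp 3 := by
    have h2 : (2.7182818283 : ℝ) ^ 3 ≤ Real.exp 1 ^ 3 := pow_le_pow_left₀ (by norm_num) h1.le 3
    rw [h3]; norm_num at h2 ⊢; linarith
  rw [Real.exp_neg, inv_eq_one_div, div_le_div_iff₀ (Real.exp_pos 3) (by norm_num)]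
  linarith

/-- Decay at `a ≥ 2`: `x = e^{−κ/4} = e^{−πa/2} ≤ e^{−3} ≤ 1/20`. [folklore] -/
theorem exp_neg_quarter_kappa_le_two (ha : 2 ≤ a) : Real.exp (-(2 * Real.pi * a) / 4) ≤ 1 / 20 := by
  have h3 : -(2 * Real.pi * a) / 4 ≤ -3 := by nlinarith [Real.pi_gt_three]
  exact (Real.exp_le_exp.2 h3).trans exp_neg_three_le

/-- `q = e^{−κ} = x⁴ ≤ (1/20)⁴` at `a ≥ 2`. [folklore] -/
theorem exp_neg_kappa_le_pow_two (ha : 2 ≤ a) : Real.exp (-(2 * Real.pi * a)) ≤ (1 / 20) ^ 4 := by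
  have hx := exp_neg_quarter_kappa_le_two ha
  have e : Real.exp (-(2 * Real.pi * a)) = Real.exp (-(2 * Real.pi * a) / 4) ^ 4 := by
    rw [← Real.exp_nat_mul]; congr 1; push_cast; ring
  rw [e]
  exact pow_le_pow_left₀ (Real.exp_pos _).le hx 4

/-- `4‖S‖/(p − 2‖S‖) ≤ 1/100` at `a ≥ 2` (`‖S‖ ≤ √q/(a(1−q))`, `√q = e^{−πa} ≤ 1/400`). [cite: Drazin2002, §8.3 (8.36)–(8.38)] -/
theorem comb_ratio_defect_le_two (ha : 2 ≤ a) (β : ℝ) :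
    4 * ‖sawS a β‖ / ((Real.pi / 2 + 2 * sawSigma0 a β) - 2 * ‖sawS a β‖) ≤ 0.01 := by
  have ha1 : 1 ≤ a := by linarith
  have ha0 : 0 < a := by linarith
  have hp := kh_p_ge ha1 β
  have hq : sawQ a ≤ 1 / 400 := sawQ_le_of_one_le ha1
  have hq0 : 0 < sawQ a := sawQ_pos a
  have hsq : Real.sqrt (sawQ a) ≤ 1 / 400 := by
    have h2 : sawQ (a / 2) ≤ 1 / 400 := sawQ_le_of_one_le (by linarith)
    have e : Real.sqrt (sawQ a) = sawQ (a / 2) := by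
      rw [show sawQ a = sawQ (a / 2) ^ 2 by unfold sawQ; rw [← Real.exp_nat_mul]; congr 1; push_cast; ring]
      exact Real.sqrt_sq (sawQ_pos _).le
    rw [e]; exact h2
  have hu : ‖sawS a β‖ ≤ 0.00126 := by
    refine (norm_sawS_le ha0 β).trans ?_
    have h1q : 0.9975 ≤ 1 - sawQ a := by norm_num at hq ⊢; linarith
    rw [div_le_iff₀ (by nlinarith)]
    have h4 : 2 * (1 - sawQ a) ≤ a * (1 - sawQ a) := mul_le_mul_of_nonneg_right ha (by linarith)
    norm_num at hsq ⊢
    nlinarith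
  have hpu : 0 < (Real.pi / 2 + 2 * sawSigma0 a β) - 2 * ‖sawS a β‖ := by linarith
  rw [div_le_iff₀ hpu]
  nlinarith [norm_nonneg (sawS a β)]

/-- **The paired mode factor at `a ≥ 2`, near modes:** `≤ 5.08/a` (comb ratio ≤ 1.01, `1 + q + 2x² ≤ 1.00500625`, `arctan` window ≤ π). [folklore] -/
theorem paired_mode_factor_le_two {a : ℝ} (ha : 2 ≤ a) (β ξ : ℝ) {θ : ℝ} (hθ0 : 0 ≤ θ) (hθ : θ ≤ 8) :
    4 * Real.pi * a * (a * (Real.pi / 2 + 2 * sawSigma0 a β) + 2 * a * ‖sawS a β‖) / (a * Real.sqrt (max 0 (sawC2 a β))) *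
        ((1 + Real.exp (-(2 * Real.pi * a)) + 2 * Real.exp (-(2 * Real.pi * a) / 4) ^ 2) * (1 + θ / 2) *
          (Real.arctan (ξ / a + θ) - Real.arctan (ξ / a - θ)) / ((1 - Real.exp (-(2 * Real.pi * a))) * (2 * Real.pi * a) ^ 2)) ≤ 5.08 / a := by
  have ha1 : 1 ≤ a := by linarith
  have ha0 : 0 < a := by linarith
  have hπ : (3.1415 : ℝ) < Real.pi := Real.pi_gt_d4
  have hπ' : Real.pi < 3.1416 := Real.pi_lt_d4
  have hR : (a * (Real.pi / 2 + 2 * sawSigma0 a β) + 2 * a * ‖sawS a β‖) / (a * Real.sqrt (max 0 (sawC2 a β))) ≤ 1.01 :=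
    (comb_ratio_le ha1 β).trans (by linarith [comb_ratio_defect_le_two ha β])
  have hR0 : 0 ≤ (a * (Real.pi / 2 + 2 * sawSigma0 a β) + 2 * a * ‖sawS a β‖) / (a * Real.sqrt (max 0 (sawC2 a β))) := by
    have := kh_p_ge ha1 β; positivity
  have hx := exp_neg_quarter_kappa_le_two ha
  have hx0 : 0 ≤ Real.exp (-(2 * Real.pi * a) / 4) := (Real.exp_pos _).le
  have hq : Real.exp (-(2 * Real.pi * a)) ≤ (1 / 20) ^ 4 := exp_neg_kappa_le_pow_two ha
  have hq0 : 0 < Real.exp (-(2 * Real.pi * a)) := Real.exp_pos _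
  have hW := arctan_window_le_pi (ξ / a) θ
  have hW0 := arctan_window_nonneg hθ0 (ξ / a)
  set x := Real.exp (-(2 * Real.pi * a) / 4) with hxdef
  set q := Real.exp (-(2 * Real.pi * a)) with hqdef
  set R := (a * (Real.pi / 2 + 2 * sawSigma0 a β) + 2 * a * ‖sawS a β‖) / (a * Real.sqrt (max 0 (sawC2 a β))) with hR_def
  set W := Real.arctan (ξ / a + θ) - Real.arctan (ξ / a - θ) with hW_def
  have hN : 1 + q + 2 * x ^ 2 ≤ 1.00500625 := by
    have h2 : x ^ 2 ≤ (1 / 20) ^ 2 := pow_le_pow_left₀ hx0 hx 2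
    norm_num at h2 hq ⊢; linarith
  have h1q : 0 < 1 - q := by norm_num at hq; linarith
  have h1q' : 1 / (1 - q) ≤ 1.00001 := by
    rw [div_le_iff₀ h1q]; norm_num at hq ⊢; linarith
  have e : 4 * Real.pi * a * (a * (Real.pi / 2 + 2 * sawSigma0 a β) + 2 * a * ‖sawS a β‖) / (a * Real.sqrt (max 0 (sawC2 a β))) *
        ((1 + q + 2 * x ^ 2) * (1 + θ / 2) * W / ((1 - q) * (2 * Real.pi * a) ^ 2)) =
      (R * ((1 + q + 2 * x ^ 2) * ((1 + θ / 2) * W)) * (1 / (1 - q))) / (Real.pi * a) := by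
    rw [hR_def]; field_simp; ring
  rw [e, div_le_div_iff₀ (by positivity) ha0]
  have hTW : (1 + θ / 2) * W ≤ 5 * Real.pi := by
    have : (1 + θ / 2) ≤ 5 := by linarith
    exact mul_le_mul this hW hW0 (by norm_num)
  have hTW0 : 0 ≤ (1 + θ / 2) * W := by positivity
  have h2 : (1 + q + 2 * x ^ 2) * ((1 + θ / 2) * W) ≤ 1.00500625 * (5 * Real.pi) := mul_le_mul hN hTW hTW0 (by norm_num)
  have h20 : 0 ≤ (1 + q + 2 * x ^ 2) * ((1 + θ / 2) * W) := by positivity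
  have h3 : (1 + q + 2 * x ^ 2) * ((1 + θ / 2) * W) * (1 / (1 - q)) ≤ 1.00500625 * (5 * Real.pi) * 1.00001 :=
    mul_le_mul h2 h1q' (by positivity) (by positivity)
  have h30 : 0 ≤ (1 + q + 2 * x ^ 2) * ((1 + θ / 2) * W) * (1 / (1 - q)) := by positivity
  have h4 : R * ((1 + q + 2 * x ^ 2) * ((1 + θ / 2) * W) * (1 / (1 - q))) ≤ 1.01 * (1.00500625 * (5 * Real.pi) * 1.00001) :=
    mul_le_mul hR h3 h30 (by norm_num)
  nlinarith

/-- **The paired mode factor at `a ≥ 2`, far modes:** `≤ 26/(a(1+(|ξ/a|−8)²))` for `|ξ| ≥ 16a`. [folklore] -/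
theorem paired_mode_factor_far_le_two {a : ℝ} (ha : 2 ≤ a) (β ξ : ℝ) {θ : ℝ} (hθ0 : 0 ≤ θ) (hθ : θ ≤ 8) (hfar : 16 * a ≤ |ξ|) :
    4 * Real.pi * a * (a * (Real.pi / 2 + 2 * sawSigma0 a β) + 2 * a * ‖sawS a β‖) / (a * Real.sqrt (max 0 (sawC2 a β))) *
        ((1 + Real.exp (-(2 * Real.pi * a)) + 2 * Real.exp (-(2 * Real.pi * a) / 4) ^ 2) * (1 + θ / 2) *
          (Real.arctan (ξ / a + θ) - Real.arctan (ξ / a - θ)) / ((1 - Real.exp (-(2 * Real.pi * a))) * (2 * Real.pi * a) ^ 2)) ≤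
      26 / (a * (1 + (|ξ / a| - 8) ^ 2)) := by
  have ha1 : 1 ≤ a := by linarith
  have ha0 : 0 < a := by linarith
  have hπ : (3.1415 : ℝ) < Real.pi := Real.pi_gt_d4
  have hR : (a * (Real.pi / 2 + 2 * sawSigma0 a β) + 2 * a * ‖sawS a β‖) / (a * Real.sqrt (max 0 (sawC2 a β))) ≤ 1.01 :=
    (comb_ratio_le ha1 β).trans (by linarith [comb_ratio_defect_le_two ha β])
  have hR0 : 0 ≤ (a * (Real.pi / 2 + 2 * sawSigma0 a β) + 2 * a * ‖sawS a β‖) / (a * Real.sqrt (max 0 (sawC2 a β))) := by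
    have := kh_p_ge ha1 β; positivity
  have hx := exp_neg_quarter_kappa_le_two ha
  have hx0 : 0 ≤ Real.exp (-(2 * Real.pi * a) / 4) := (Real.exp_pos _).le
  have hq : Real.exp (-(2 * Real.pi * a)) ≤ (1 / 20) ^ 4 := exp_neg_kappa_le_pow_two ha
  have hq0 : 0 < Real.exp (-(2 * Real.pi * a)) := Real.exp_pos _
  have hu : 16 ≤ |ξ / a| := by rw [abs_div, abs_of_pos ha0, le_div_iff₀ ha0]; linarith
  have hW := arctan_window_le_far_abs hθ0 (show θ ≤ |ξ / a| by linarith)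
  have hW0 := arctan_window_nonneg hθ0 (ξ / a)
  set x := Real.exp (-(2 * Real.pi * a) / 4) with hxdef
  set q := Real.exp (-(2 * Real.pi * a)) with hqdef
  set R := (a * (Real.pi / 2 + 2 * sawSigma0 a β) + 2 * a * ‖sawS a β‖) / (a * Real.sqrt (max 0 (sawC2 a β))) with hR_def
  set W := Real.arctan (ξ / a + θ) - Real.arctan (ξ / a - θ) with hW_def
  set v := |ξ / a| with hv
  have hN : 1 + q + 2 * x ^ 2 ≤ 1.00500625 := by
    have h2 : x ^ 2 ≤ (1 / 20) ^ 2 := pow_le_pow_left₀ hx0 hx 2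
    norm_num at h2 hq ⊢; linarith
  have h1q : 0 < 1 - q := by norm_num at hq; linarith
  have h1q' : 1 / (1 - q) ≤ 1.00001 := by
    rw [div_le_iff₀ h1q]; norm_num at hq ⊢; linarith
  have hL0 : 0 < 1 + (v - 8) ^ 2 := by positivity
  have hTW : (1 + θ / 2) * W ≤ 80 / (1 + (v - 8) ^ 2) := by
    have h1 : (1 + θ / 2) * W ≤ (1 + θ / 2) * (2 * θ / (1 + (v - θ) ^ 2)) := mul_le_mul_of_nonneg_left hW (by linarith)
    refine h1.trans ?_
    rw [mul_div_assoc', div_le_div_iff₀ (by positivity) hL0]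
    have hA : (1 + θ / 2) * (2 * θ) ≤ 80 := by nlinarith
    have hB : 1 + (v - 8) ^ 2 ≤ 1 + (v - θ) ^ 2 := by nlinarith
    have hA0 : 0 ≤ (1 + θ / 2) * (2 * θ) := by positivity
    calc (1 + θ / 2) * (2 * θ) * (1 + (v - 8) ^ 2) ≤ 80 * (1 + (v - 8) ^ 2) := mul_le_mul_of_nonneg_right hA hL0.le
      _ ≤ 80 * (1 + (v - θ) ^ 2) := mul_le_mul_of_nonneg_left hB (by norm_num)
  have hTW0 : 0 ≤ (1 + θ / 2) * W := by positivity
  have e : 4 * Real.pi * a * (a * (Real.pi / 2 + 2 * sawSigma0 a β) + 2 * a * ‖sawS a β‖) / (a * Real.sqrt (max 0 (sawC2 a β))) *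
        ((1 + q + 2 * x ^ 2) * (1 + θ / 2) * W / ((1 - q) * (2 * Real.pi * a) ^ 2)) =
      (R * ((1 + q + 2 * x ^ 2) * ((1 + θ / 2) * W)) * (1 / (1 - q))) / (Real.pi * a) := by
    rw [hR_def]; field_simp; ring
  rw [e, div_le_div_iff₀ (by positivity) (by positivity)]
  have h2 : (1 + q + 2 * x ^ 2) * ((1 + θ / 2) * W) ≤ 1.00500625 * (80 / (1 + (v - 8) ^ 2)) := mul_le_mul hN hTW hTW0 (by norm_num)
  have h20 : 0 ≤ (1 + q + 2 * x ^ 2) * ((1 + θ / 2) * W) := by positivity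
  have h3 : (1 + q + 2 * x ^ 2) * ((1 + θ / 2) * W) * (1 / (1 - q)) ≤ 1.00500625 * (80 / (1 + (v - 8) ^ 2)) * 1.00001 :=
    mul_le_mul h2 h1q' (by positivity) (by positivity)
  have h30 : 0 ≤ (1 + q + 2 * x ^ 2) * ((1 + θ / 2) * W) * (1 / (1 - q)) := by positivity
  have h4 : R * ((1 + q + 2 * x ^ 2) * ((1 + θ / 2) * W) * (1 / (1 - q))) ≤ 1.01 * (1.00500625 * (80 / (1 + (v - 8) ^ 2)) * 1.00001) :=
    mul_le_mul hR h3 h30 (by norm_num)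
  have h5 : 1.01 * (1.00500625 * (80 / (1 + (v - 8) ^ 2)) * 1.00001) * (a * (1 + (v - 8) ^ 2)) =
      1.01 * 1.00500625 * 80 * 1.00001 * a := by field_simp
  calc R * ((1 + q + 2 * x ^ 2) * ((1 + θ / 2) * W)) * (1 / (1 - q)) * (a * (1 + (v - 8) ^ 2))
      = R * ((1 + q + 2 * x ^ 2) * ((1 + θ / 2) * W) * (1 / (1 - q))) * (a * (1 + (v - 8) ^ 2)) := by ring
    _ ≤ 1.01 * (1.00500625 * (80 / (1 + (v - 8) ^ 2)) * 1.00001) * (a * (1 + (v - 8) ^ 2)) :=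
        mul_le_mul_of_nonneg_right h4 (by positivity)
    _ = 1.01 * 1.00500625 * 80 * 1.00001 * a := h5
    _ ≤ 26 * (Real.pi * a) := by nlinarith

/-- **The square sum of the creation weights at `a ≥ 2`:** with the near weight `5.08/a` on `|β+n| < 16a` and the far weight `104a/(β+n)²` beyond,
`Σ_{|n| ≤ K} W²·(a²+(β+n)²) ≤ 220000·a` (`|β| ≤ 1`, any window). [folklore] -/
theorem sum_sq_creationWeight_le_two {a : ℝ} (ha : 2 ≤ a) {β : ℝ} (hβ : |β| ≤ 1) (K : ℕ) :
    ∑ n ∈ Finset.Icc (-(K : ℤ)) K,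
        (if |β + n| < 16 * a then (5.08 / a) ^ 2 * (a ^ 2 + (β + n) ^ 2) else (104 * a / (β + n) ^ 2) ^ 2 * (a ^ 2 + (β + n) ^ 2)) ≤
      220000 * a := by
  have ha0 : 0 < a := by linarith
  -- near part: each term ≤ 5.08²·257 ≤ 6633 and there are at most `32a + 1` of them
  have hnear : ∑ n ∈ Finset.Icc (-(K : ℤ)) K, (if |β + n| < 16 * a then (5.08 / a) ^ 2 * (a ^ 2 + (β + n) ^ 2) else 0) ≤
      6633 * (2 * (16 * a) + 1) := by
    have hpt : ∀ n ∈ Finset.Icc (-(K : ℤ)) K, (if |β + n| < 16 * a then (5.08 / a) ^ 2 * (a ^ 2 + (β + n) ^ 2) else (0 : ℝ)) ≤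
        if |β + n| < 16 * a then (6633 : ℝ) else 0 := by
      intro n _
      split_ifs with h
      · have hb : (β + n) ^ 2 < (16 * a) ^ 2 := by
          have := abs_lt.1 h; nlinarith [this.1, this.2]
        rw [div_pow, div_mul_eq_mul_div, div_le_iff₀ (by positivity)]
        nlinarith
      · exact le_rfl
    refine (Finset.sum_le_sum hpt).trans ?_
    rw [← Finset.sum_filter, Finset.sum_const, nsmul_eq_mul]
    have hc := card_filter_abs_lt_le β (show 0 ≤ 16 * a by positivity) (Finset.Icc (-(K : ℤ)) K)
    nlinarith
  -- far part: each term ≤ 10859·a²/(β+n)²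
  have hfar : ∑ n ∈ Finset.Icc (-(K : ℤ)) K, (if |β + n| < 16 * a then 0 else (104 * a / (β + n) ^ 2) ^ 2 * (a ^ 2 + (β + n) ^ 2)) ≤
      10859 * a ^ 2 * (2 / (16 * a - 4)) := by
    have hpt : ∀ n ∈ Finset.Icc (-(K : ℤ)) K, (if |β + n| < 16 * a then (0 : ℝ) else (104 * a / (β + n) ^ 2) ^ 2 * (a ^ 2 + (β + n) ^ 2)) ≤
        10859 * a ^ 2 * (if |β + n| < 16 * a then (0 : ℝ) else 1 / (β + n) ^ 2) := by
      intro n _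
      split_ifs with h
      · simp
      · replace h := not_lt.mp h
        have hb2 : (16 * a) ^ 2 ≤ (β + n) ^ 2 := by
          calc (16 * a) ^ 2 ≤ |β + n| ^ 2 := pow_le_pow_left₀ (by positivity) h 2
            _ = (β + n) ^ 2 := sq_abs _
        have hb0 : 0 < (β + n) ^ 2 := by nlinarith
        rw [div_pow, div_mul_eq_mul_div, show 10859 * a ^ 2 * (1 / (β + ↑n) ^ 2) = 10859 * a ^ 2 / (β + n) ^ 2 by ring,
          div_le_div_iff₀ (by positivity) hb0]
        have h43 : 10816 * a ^ 2 ≤ 43 * (β + n) ^ 2 := by nlinarith [hb2]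
        have key : (104 * a) ^ 2 * (a ^ 2 + (β + n) ^ 2) ≤ 10859 * a ^ 2 * (β + n) ^ 2 := by nlinarith [h43, sq_nonneg a]
        calc (104 * a) ^ 2 * (a ^ 2 + (β + ↑n) ^ 2) * (β + ↑n) ^ 2 ≤ 10859 * a ^ 2 * (β + n) ^ 2 * (β + n) ^ 2 :=
              mul_le_mul_of_nonneg_right key hb0.le
          _ = 10859 * a ^ 2 * ((β + ↑n) ^ 2) ^ 2 := by ring
    refine (Finset.sum_le_sum hpt).trans ?_
    rw [← Finset.mul_sum]
    exact mul_le_mul_of_nonneg_left (sum_Icc_inv_sq_far_le hβ (by linarith) K) (by positivity)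
  have hsplit : ∑ n ∈ Finset.Icc (-(K : ℤ)) K,
        (if |β + n| < 16 * a then (5.08 / a) ^ 2 * (a ^ 2 + (β + n) ^ 2) else (104 * a / (β + n) ^ 2) ^ 2 * (a ^ 2 + (β + n) ^ 2)) =
      (∑ n ∈ Finset.Icc (-(K : ℤ)) K, (if |β + n| < 16 * a then (5.08 / a) ^ 2 * (a ^ 2 + (β + n) ^ 2) else 0)) +
        ∑ n ∈ Finset.Icc (-(K : ℤ)) K, (if |β + n| < 16 * a then 0 else (104 * a / (β + n) ^ 2) ^ 2 * (a ^ 2 + (β + n) ^ 2)) := by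
    rw [← Finset.sum_add_distrib]
    exact Finset.sum_congr rfl fun n _ => by split_ifs <;> simp
  rw [hsplit]
  refine (add_le_add hnear hfar).trans ?_
  have h16 : 14 * a ≤ 16 * a - 4 := by linarith
  have hq : 2 / (16 * a - 4) ≤ 2 / (14 * a) := div_le_div_of_nonneg_left (by norm_num) (by positivity) h16
  have h1 : 10859 * a ^ 2 * (2 / (16 * a - 4)) ≤ 10859 * a ^ 2 * (2 / (14 * a)) := mul_le_mul_of_nonneg_left hq (by positivity)
  have h2 : 10859 * a ^ 2 * (2 / (14 * a)) ≤ 1552 * a := by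
    rw [mul_div_assoc', div_le_iff₀ (by positivity)]; nlinarith
  nlinarith

end

end Summit.AnomalousDissipation.AnomalousDissipation.Theorems.SawtoothPulseCascade.K2PhaseBudget
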